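import Summits.QuantumFields.YangMills.Theorems.F4SubCurvatureDoorGlobalReductionCertificate
import Summits.QuantumFields.YangMills.Theorems.F4SubCurvatureDoorMirrorAnalyticityRegistered
import Mathlib
import HarnessLib

/-!
# LINE g19-A «transverse slice» on crux ⟨stmt-QuantumFields-23035⟩ `F4SubCurvatureDoor.ShortRootRigidity`

D-0145 ideator seat `ym-idea-3` (generation 19), technique card «positivity / convexity».  A SECOND, mechanism-distinct
skeleton for the route crux `ShortRootRigidity` (equivalently its global form C3, tree certificate
`F4SubCurvatureDoorGlobalReduction.shortRootRigidity_iff_global`), next to the line of record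
`Cruxes/RationalToGeneral/Lines/sextic_channel.lean` (finite harmonic type in `ℝ⁴`).

## The lever (new on this crux): POSITIVITY-PRESERVING TRANSVERSE SLICING, `ℝ⁴ → ℝ²`

Fix the 60° short-root plane `Π₀ = span(e₀, n₂)`, `n₂ = ½(1,1,1,1)`, with orthonormal frame `(e₀, m)`, `m = (0,1,1,1)/√3`,
and its orthogonal complement `Π₀^⊥ = {x₀ = 0, x₁+x₂+x₃ = 0}` with frame `b₁ = (0,1,−1,0)/√2`, `b₂ = (0,1,1,−2)/√6`.
For a kernel `K` of the C3 class and a Gaussian–cosine weight `w_a(x) = cos⟪a,x⟫·e^{−‖x‖²/2}` on `Π₀^⊥ ≅ ℝ²`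
(`a ∈ ℝ²`; these weights are positive-definite and even, and their span separates even functions) put

  `slice K a (y) := ∫_{ℝ²} K(ι y + ι^⊥ x) · w_a(x) dx`,  `y ∈ ℝ² ≅ Π₀`.

(1) `SliceInClass` — every slice lies in the PLANAR CLASS `InPlanarClass`: continuous off `0`, bounded outside the unit disc,
    invariant under the hexagonal group `D₆ = ⟨σ_{e₀}, σ_{n₂}, −1⟩|_{Π₀}` (the two reflections fix `Π₀^⊥` pointwise, the weight is
    even), REFLECTION POSITIVE across `y₀ = 0` INSIDE THE PLANE (the cone of RP kernels is convex and closed: 4D reflection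
    positivity tested on Gaussian-modulated transverse plane-wave families gives `∫ S(x) cos⟪a,x⟫ e^{−‖x‖²/2} dx ≥ 0` for
    `S(x) = Σ cᵢcⱼ K(θYᵢ − Yⱼ + ι^⊥x)`), and with the 2D sub-curvature budget `‖y‖⁶·k(y) → 0`
    (`∫ d²x (‖y‖²+‖x‖²)^{-4} = π/3 · ‖y‖^{-6}`).  Routine measure theory, size M–L.
(2) `PlanarRigidity` — THE HEART, a self-contained TWO-dimensional statement: every kernel of the planar class is `O(2)`-invariant
    off `0`.  It is the honest 2D shadow of C3: the first `D₆`-invariant anisotropic harmonic is `Re (y₀+iy₁)⁶`, whose natural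
    strength `‖y‖^{-6}` is exactly what the 2D budget forbids (as `‖x‖^{-8}` forbids the `W(F₄)` sextic channel in 4D).
    WHY EASIER THAN C3: the Laplace–Fourier measure lives on `[0,∞) × ℝ¹` (one spatial momentum; the spectral threshold is a
    function of ONE variable), the function theory is that of separately-Stieltjes / Pick functions of TWO variables
    (Agler–McCarthy–Young, Luger–Nedić; the cross theorem in `ℂ²`, JarnickiPflug2011 Ch. 5), the `D₆`-harmonic channels are the
    single family `cos 6jφ` (no multiplicities: the T1″ tower combinatorics is one-parameter), and its finite-type / polynomial
    rungs are IN THE TREE (`HexagonPolynomialFinal`, `HexagonRealRootedO2.realRootedO2_or_zero`, hexagon normal form Defs).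
(3) `SliceDensity` — if every slice is rotation invariant then the `y`-even part of `K` on `Π₀ ⊕ Π₀^⊥` is `SO(2)_{Π₀}`-invariant
    (Fourier uniqueness for even functions against the Gaussian–cosine family; `K` is even).  Size S–M.
(4) `OddModeRigidity` — even-part slice invariance for the one plane `Π₀` + the C3 hypotheses (`W(F₄)` moves `Π₀` to all sixteen
    60° planes; `K` is real-analytic off `0` by the tree theorem `stub_mirrorAnalyticity`) ⇒ full `O(4)`-invariance.  Its
    combinatorial core is the ODD-MODE RIGIDITY of `W(F₄)`-invariant spherical harmonics: for every degree `L ≥ 1`, no non-zero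
    `h ∈ Harm_L(ℝ⁴)^{W(F₄)}` has all its even non-zero `SO(2)_{Π₀}`-Fourier modes vanishing (modes are automatically `≡ 0 mod 3`
    since the 120° rotation of `Π₀` lies in `W(F₄)`).  VERIFIED EXACTLY (rational arithmetic) for `L ≤ 18`
    (`dim Harm_L^{W(F₄)} = 1,1,2,1,1,2` at `L = 6,8,12,14,16,18`; kernel of `h ↦ L_{Π₀}(h + h∘P)` is `0` in every case;
    HOME l19/omr_check.py).  Size M–L (needs the harmonic expansion on `S³` and a proof for all `L`).

Composition (kernel-checked below): (1)+(2) ⇒ all slices rotation-invariant ⇒ (3) even-part slice invariance ⇒ (4) global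
`O(4)`-invariance = C3 ⇒ `ShortRootRigidity` by the tree certificate `shortRootRigidity_of_global`.

bears_on: rung R2d (`BalabanLadder.ROT`) via `F4SubCurvatureDoor.closes`; crux ⟨23035⟩ (hence ⟨23125⟩ `RationalToGeneral`,
since ⟨23124⟩ is proved).  Cheapest falsifier: a degree `L` with a `W(F₄)`-invariant harmonic whose `Π₀`-modes are all odd
multiples of 3 (kills (4); exact linear algebra per degree), or a non-radial kernel in the 2D class (kills (2); 2D shell LP /
hexagon numerics).  Instrument row that would refute the key lemma (2): a `D₆`-symmetric, three-direction reflection-positive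
planar two-point function with a NON-circular spectral threshold curve inside the `‖y‖^{-6}` budget.
HONEST LABEL: a skeleton; stubs (1)–(4) are OPEN here ((1),(3) routine, (4) checked through degree 18, (2) is the wall moved to
two dimensions); nothing about ⟨23035⟩, ⟨23125⟩, R2d or the Yang–Mills mass gap is proved by this file; no summit is proved by a line.
-/

noncomputable section

namespace Summit.QuantumFields.YangMills.Cruxes.ShortRootRigidity.TransverseSlice

open scoped Topology BigOperators
open Filter Set MeasureTheory
open Literature.MathematicalPhysics.QuantumLattice (timeReflection siteToE)
open Summit.QuantumFields.YangMills.Cruxes.OSLegsAtWeakCouplingC.Sketch (IsSignedPerm)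
open Summit.QuantumFields.YangMills.Theorems.F4SubCurvatureDoorMirrorAnalyticityRegistered (E4 InClass)
open Summit.QuantumFields.YangMills.Theses.F4SubCurvatureDoor (ShortRootRigidity)

/-- The plane `ℝ²` (coordinates w.r.t. the frame `(e₀, m)` of `Π₀`, resp. `(b₁, b₂)` of `Π₀^⊥`). -/
abbrev E2 := EuclideanSpace ℝ (Fin 2)

/-- `ι : ℝ² → Π₀ ⊂ ℝ⁴`, `y ↦ y₀ e₀ + y₁ m`, `m = (0,1,1,1)/√3` (so `ι(1,0) = e₀` and `ι(½, √3/2) = ½(1,1,1,1) = n₂`, a short root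
of `F₄` at 60° from `e₀`). [problem-side definition] -/
def planeEmb (y : E2) : E4 :=
  (WithLp.equiv 2 (Fin 4 → ℝ)).symm ![y 0, y 1 / Real.sqrt 3, y 1 / Real.sqrt 3, y 1 / Real.sqrt 3]

/-- `ι^⊥ : ℝ² → Π₀^⊥ ⊂ ℝ⁴`, `x ↦ x₀ b₁ + x₁ b₂`, `b₁ = (0,1,−1,0)/√2`, `b₂ = (0,1,1,−2)/√6`. [problem-side definition] -/
def perpEmb (x : E2) : E4 :=
  (WithLp.equiv 2 (Fin 4 → ℝ)).symm
    ![0, x 0 / Real.sqrt 2 + x 1 / Real.sqrt 6, -(x 0 / Real.sqrt 2) + x 1 / Real.sqrt 6, -(2 * x 1 / Real.sqrt 6)]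

/-- The Gaussian–cosine weight `w_a(x) = cos⟪a,x⟫ e^{−‖x‖²/2}` on `Π₀^⊥ ≅ ℝ²` (positive-definite, even). [problem-side definition] -/
def weight (a x : E2) : ℝ := Real.cos (inner ℝ a x) * Real.exp (-(‖x‖ ^ 2 / 2))

/-- The TRANSVERSE SLICE of `K` along `Π₀` with weight `w_a`: `y ↦ ∫ K(ι y + ι^⊥ x) w_a(x) dx`. [problem-side definition] -/
def slice (K : E4 → ℝ) (a : E2) (y : E2) : ℝ := ∫ x : E2, K (planeEmb y + perpEmb x) * weight a x

/-- The hexagonal reflection of the plane: reflection in the line orthogonal to `n' = (½, √3/2)` (the image of `σ_{n₂}` under `ι`).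
[problem-side definition] -/
def hexReflection (y : E2) : E2 :=
  (WithLp.equiv 2 (Fin 2 → ℝ)).symm ![y 0 / 2 - Real.sqrt 3 / 2 * y 1, -(Real.sqrt 3 / 2 * y 0) - y 1 / 2]

/-- THE PLANAR CLASS: `k : ℝ² → ℝ` continuous off `0`, bounded outside the unit disc, invariant under the hexagonal group
`D₆ = ⟨θ₂, σ_{n'}, −1⟩`, reflection positive across `y₀ = 0` inside the plane, with the 2D sub-curvature budget `‖y‖⁶ k → 0`.
[problem-side definition] -/
def InPlanarClass (k : E2 → ℝ) : Prop :=
  ContinuousOn k {y | y ≠ 0} ∧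
  (∃ C : ℝ, ∀ y, 1 ≤ ‖y‖ → |k y| ≤ C) ∧
  (∀ y, k (timeReflection 2 y) = k y) ∧
  (∀ y, k (hexReflection y) = k y) ∧
  (∀ y, k (-y) = k y) ∧
  (∀ (m : ℕ) (y : Fin m → E2) (c : Fin m → ℝ), (∀ i, 0 < y i 0) →
      0 ≤ ∑ i, ∑ j, c i * c j * k (timeReflection 2 (y i) - y j)) ∧
  Tendsto (fun y : E2 => ‖y‖ ^ 6 * k y) (𝓝[≠] 0) (𝓝 0)

/-- Obligation (1) «SLICES ARE PLANAR KERNELS»: every transverse slice of a kernel of the C3 class lies in the planar class. -/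
def SliceInClass : Prop :=
  ∀ K : E4 → ℝ, InClass K → ∀ a : E2, InPlanarClass (slice K a)

/-- Obligation (2) «PLANAR RIGIDITY» (the heart, two-dimensional): every kernel of the planar class is `O(2)`-invariant off `0`. -/
def PlanarRigidity : Prop :=
  ∀ k : E2 → ℝ, InPlanarClass k → ∀ (R : E2 ≃ₗᵢ[ℝ] E2) (y : E2), y ≠ 0 → k (R y) = k y

/-- Even-part slice invariance of `K` along `Π₀`: `y ↦ K(ι y + ι^⊥ x) + K(−ι y + ι^⊥ x)` is `O(2)_{Π₀}`-invariant for every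
transverse `x`. [problem-side definition] -/
def EvenPartSliceInvariant (K : E4 → ℝ) : Prop :=
  ∀ (R : E2 ≃ₗᵢ[ℝ] E2) (y x : E2),
    K (planeEmb (R y) + perpEmb x) + K (-planeEmb (R y) + perpEmb x) =
      K (planeEmb y + perpEmb x) + K (-planeEmb y + perpEmb x)

/-- Obligation (3) «SLICE DENSITY»: rotation invariance of all Gaussian–cosine slices gives even-part slice invariance
(Fourier uniqueness for even functions; `K` is even). -/
def SliceDensity : Prop :=
  ∀ K : E4 → ℝ, InClass K →
    (∀ (a : E2) (R : E2 ≃ₗᵢ[ℝ] E2) (y : E2), y ≠ 0 → slice K a (R y) = slice K a y) →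
    EvenPartSliceInvariant K

/-- Obligation (4) «ODD-MODE RIGIDITY»: even-part slice invariance along the one plane `Π₀`, together with the C3 hypotheses
(`W(F₄)`-invariance moves `Π₀` to all sixteen 60° planes; analyticity off `0` is the tree theorem `stub_mirrorAnalyticity`),
forces full `O(4)`-invariance.  Core: no non-zero `W(F₄)`-invariant spherical harmonic of degree `L ≥ 1` has all even non-zero
`SO(2)_{Π₀}`-modes vanishing (checked exactly for `L ≤ 18`). -/
def OddModeRigidity : Prop :=
  ∀ K : E4 → ℝ, InClass K → EvenPartSliceInvariant K → ∀ (R : E4 ≃ₗᵢ[ℝ] E4) (x : E4), K (R x) = K x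

/-- Registered stub (1). -/
theorem stub_sliceInClass : SliceInClass := by
  sorry

/-- Registered stub (2) — the heart (2D). -/
theorem stub_planarRigidity : PlanarRigidity := by
  sorry

/-- Registered stub (3). -/
theorem stub_sliceDensity : SliceDensity := by
  sorry

/-- Registered stub (4). -/
theorem stub_oddModeRigidity : OddModeRigidity := by
  sorry

/-- Composition, global form: the four obligations give C3 for every kernel of the class (bundled). [problem-side composition] -/
theorem global_of_obligations (h1 : SliceInClass) (h2 : PlanarRigidity) (h3 : SliceDensity) (h4 : OddModeRigidity) :
    ∀ K : E4 → ℝ, InClass K → ∀ (R : E4 ≃ₗᵢ[ℝ] E4) (x : E4), K (R x) = K x :=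
  fun K hK => h4 K hK (h3 K hK (fun a R y hy => h2 (slice K a) (h1 K hK a) R y hy))

/-- **Composition (kernel-checked): the four registered stubs imply the route crux `ShortRootRigidity` BY NAME**, through the
tree certificate `F4SubCurvatureDoorGlobalReduction.shortRootRigidity_of_global` (C3 ⇒ ⟨23035⟩).  The only theorem of this file
concluding the crux; its hypotheses are exactly the four `stub_*` (via `global_of_obligations`). [problem-side composition] -/
theorem ShortRootRigidity_of_slices : ShortRootRigidity :=
  Summit.QuantumFields.YangMills.Theorems.F4SubCurvatureDoorGlobalReduction.shortRootRigidity_of_global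
    (fun K hK hbd hB hRP hbud hlat =>
      global_of_obligations stub_sliceInClass stub_planarRigidity stub_sliceDensity stub_oddModeRigidity
        K ⟨hK, hbd, hB, hRP, hbud, hlat⟩)

end Summit.QuantumFields.YangMills.Cruxes.ShortRootRigidity.TransverseSlice

end
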